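import Literature.NumberTheory.Transcendental.KZSemiCanonicalReductionProofs
import Literature.NumberTheory.Transcendental.KZGroundingRelations
import Literature.NumberTheory.Transcendental.KZRegCalculus
import Literature.NumberTheory.Transcendental.KZCubicalCalculus
import HarnessLib

/-!
# Crux `KernelForm` (stmt-KontsevichZagierPeriods-10447), line `Sketch`: Riemann averages inside the rules

Grid machinery for the averaging normal form of `VietaFibreKernelFormAveraging.lean`: a
representation `r` with integrand `1` and domain in a box `[0, L/2ʲ)^m` is move-equivalent
(Kontsevich–Zagier rules (1) and (2) only) to ONE representation on the unit cube `[0,1]^m` whose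
integrand is the Riemann sum `w_r(y) = 2^{-jm} · #{K < L^m : (y + k_K)/2ʲ ∈ r.domain}`
(`exists_cubeAverage`): cut `r` along the closed cubes `Q_K` of the dyadic grid of level `j`
(`of_sub_sum_closedCubePieces_mem_relations`; distinct closed cubes overlap in null sets), blow
every piece `r ∩ Q_K` up onto the unit cube by `x ↦ 2ʲ x − k_K` (Jacobian `2^{jm}`) and extend by
zero (`exists_cubeSample`), then add the integrands. The Riemann sum is squeezed between the inner
and outer cube counts of `r.domain` (`card_innerIdx_mul_le_cubeAverage`), hence is uniformly
within the count gap of `vol r.domain` (`abs_cubeAverage_sub_volume_le`); the gap is controlled by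
`SemialgebraicVolume.lean` (`card_sub_card_mul_le`, `tendsto_volume_cthickening_frontier`).

References: Yoshinaga 2008 §3.4; Viu-Sos 2021 §4 (Lemma 4.3); Kontsevich–Zagier 2001 §1.2.
-/
noncomputable section

open MeasureTheory Set Filter Topology
open scoped ENNReal
open Literature.NumberTheory.Transcendental
open Literature.ModelTheory.ExponentialFields (IsSemialgebraic)

namespace Summit.KontsevichZagierPeriods.KernelForm.LocaliseAtValuePrime

variable {m : ℕ}

/-! ### Closed grid cubes -/

/-- Closed dyadic cubes are `ℚ`-semialgebraic. [folklore] -/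
theorem isSemialgebraic_closedCube (j : ℕ) (k : Fin m → ℕ) : IsSemialgebraic ℚ (closedCube j k) := by
  have h : closedCube j k = ⋂ i ∈ (Finset.univ : Finset (Fin m)),
      ({x : Fin m → ℝ | MvPolynomial.aeval x (MvPolynomial.C ((k i : ℚ) / 2 ^ j) : MvPolynomial (Fin m) ℚ) ≤
          MvPolynomial.aeval x (MvPolynomial.X i : MvPolynomial (Fin m) ℚ)} ∩
        {x : Fin m → ℝ | MvPolynomial.aeval x (MvPolynomial.X i : MvPolynomial (Fin m) ℚ) ≤
          MvPolynomial.aeval x (MvPolynomial.C (((k i : ℚ) + 1) / 2 ^ j) : MvPolynomial (Fin m) ℚ)}) := by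
    ext x
    simp only [closedCube, cubeLo, cubeHi, mem_Icc, Pi.le_def, Finset.mem_univ, iInter_true,
      mem_iInter, mem_inter_iff, mem_setOf_eq, MvPolynomial.aeval_C, MvPolynomial.aeval_X,
      eq_ratCast]
    push_cast
    exact ⟨fun h i => ⟨h.1 i, h.2 i⟩, fun h => ⟨fun i => (h i).1, fun i => (h i).2⟩⟩
  rw [h]
  exact Literature.ModelTheory.ExponentialFields.IsSemialgebraic.biInter _ _ fun i _ =>
    (Literature.ModelTheory.ExponentialFields.isSemialgebraic_setOf_eval_le _ _).inter
      (Literature.ModelTheory.ExponentialFields.isSemialgebraic_setOf_eval_le _ _)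

/-- Two distinct closed cubes of one grid level meet in a Lebesgue-null set (a piece of a
coordinate hyperplane). [folklore] -/
theorem volume_closedCube_inter_closedCube {j : ℕ} {k k' : Fin m → ℕ} (hne : k ≠ k') :
    volume (closedCube j k ∩ closedCube j k') = 0 := by
  obtain ⟨i, hi⟩ := Function.ne_iff.mp hne
  have hpos : (0 : ℝ) < 2 ^ j := by positivity
  rcases Nat.lt_or_gt_of_ne hi with hlt | hlt
  · refine measure_mono_null (fun x hx => ?_)
      (by rw [MeasureTheory.volume_pi]; exact Measure.pi_hyperplane _ i ((k' i : ℝ) / 2 ^ j))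
    have h1 : x i ≤ ((k i : ℝ) + 1) / 2 ^ j := hx.1.2 i
    have h2 : (k' i : ℝ) / 2 ^ j ≤ x i := hx.2.1 i
    have h3 : ((k i : ℝ) + 1) ≤ k' i := by exact_mod_cast hlt
    show x i = (k' i : ℝ) / 2 ^ j
    refine le_antisymm (h1.trans (div_le_div_of_nonneg_right h3 hpos.le)) h2
  · refine measure_mono_null (fun x hx => ?_)
      (by rw [MeasureTheory.volume_pi]; exact Measure.pi_hyperplane _ i ((k i : ℝ) / 2 ^ j))
    have h1 : x i ≤ ((k' i : ℝ) + 1) / 2 ^ j := hx.2.2 i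
    have h2 : (k i : ℝ) / 2 ^ j ≤ x i := hx.1.1 i
    have h3 : ((k' i : ℝ) + 1) ≤ k i := by exact_mod_cast hlt
    show x i = (k i : ℝ) / 2 ^ j
    exact le_antisymm (h1.trans (div_le_div_of_nonneg_right h3 hpos.le)) h2

/-- The sample point `(y + k) / 2ʲ` of the cube `Q_k` attached to `y ∈ [0,1]^m` lies in the closed
cube `Q_k`. [folklore] -/
theorem sample_mem_closedCube {j : ℕ} {k : Fin m → ℕ} {y : Fin m → ℝ} (hy : y ∈ KZ.cube m) :
    (fun i => (y i + k i) / 2 ^ j) ∈ closedCube j k := by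
  have hpos : (0 : ℝ) < 2 ^ j := by positivity
  refine ⟨fun i => ?_, fun i => ?_⟩
  · simp only [cubeLo]
    exact div_le_div_of_nonneg_right (by linarith [(hy i).1]) hpos.le
  · simp only [cubeHi]
    exact div_le_div_of_nonneg_right (by linarith [(hy i).2]) hpos.le

/-- Conversely, if the sample point `(y + k) / 2ʲ` lies in `Q_k` then `y ∈ [0,1]^m`. [folklore] -/
theorem mem_cube_of_sample_mem_closedCube {j : ℕ} {k : Fin m → ℕ} {y : Fin m → ℝ}
    (hy : (fun i => (y i + k i) / 2 ^ j) ∈ closedCube j k) : y ∈ KZ.cube m := by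
  have hpos : (0 : ℝ) < 2 ^ j := by positivity
  intro i
  have h1 : (k i : ℝ) / 2 ^ j ≤ (y i + k i) / 2 ^ j := hy.1 i
  have h2 : (y i + k i) / 2 ^ j ≤ ((k i : ℝ) + 1) / 2 ^ j := hy.2 i
  rw [div_le_div_iff_of_pos_right hpos] at h1 h2
  constructor <;> linarith

/-! ### One grid piece: blow-up onto the unit cube and extension by zero -/

/-- The Jacobian determinant of the dilation `x ↦ s • x` of `ℝ^m` is `s ^ m`. [folklore] -/
theorem det_smul_id_eq_pow (s : ℝ) :
    (s • ContinuousLinearMap.id ℝ (Fin m → ℝ)).det = s ^ m := by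
  rw [ContinuousLinearMap.det, ContinuousLinearMap.toLinearMap_smul, ContinuousLinearMap.coe_id,
    LinearMap.det_smul, LinearMap.det_id, mul_one, Module.finrank_fin_fun]

/-- **Blow-up of one grid piece.** Let `r` have integrand `1` on its domain and let `Q_k` be a
closed cube of level `j`. The piece `∫_{r.domain ∩ Q_k} 1` is move-equivalent to the representation
on the unit cube `[0,1]^m` with integrand `2^{-jm}` on `D_k = {y | (y + k)/2ʲ ∈ r.domain}` and `0`
elsewhere: one change of variables `x ↦ 2ʲ x − k` (Jacobian `2^{jm}`) followed by an extension by
zero (domain additivity). [cite: ViuSos2021, Lemma 4.3] [folklore] -/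
theorem exists_cubeSample (r : KZ.IntegralRep m) (h1 : ∀ x ∈ r.domain, r.integrand x = 1)
    (j : ℕ) (k : Fin m → ℕ) :
    ∃ E : KZ.IntegralRep m, E.domain = KZ.cube m ∧
      (E.integrand = {y : Fin m → ℝ | (fun i => (y i + k i) / 2 ^ j) ∈ r.domain}.indicator
        fun _ => ((1 : ℝ) / 2 ^ j) ^ m) ∧
      KZ.of (r.restrict (r.domain ∩ closedCube j k)
          (r.isSemialgebraic_domain.inter (isSemialgebraic_closedCube j k)) inter_subset_left) -
        KZ.of E ∈ KZ.relations := by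
  have hpos : (0 : ℝ) < 2 ^ j := by positivity
  have hconst : ∀ {s : Set (Fin m → ℝ)}, IsSemialgebraic ℚ s →
      IsSemialgebraicFunOn ℚ s (fun _ => ((1 : ℝ) / 2 ^ j) ^ m) := fun hs =>
    (isSemialgebraicFunOn_ratCast hs (((1 : ℚ) / 2 ^ j) ^ m)).congr fun x _ => by push_cast; ring
  set P := r.restrict (r.domain ∩ closedCube j k)
    (r.isSemialgebraic_domain.inter (isSemialgebraic_closedCube j k)) inter_subset_left with hP
  -- the sample map `z y = (y + k) / 2ʲ` is polynomial
  set z : (Fin m → ℝ) → (Fin m → ℝ) := fun y i => (y i + k i) / 2 ^ j with hz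
  have hzpoly : ∀ y : Fin m → ℝ, (fun i => MvPolynomial.aeval y
      ((MvPolynomial.X i + MvPolynomial.C (k i : ℚ)) * MvPolynomial.C ((1 : ℚ) / 2 ^ j) :
        MvPolynomial (Fin m) ℚ)) = z y := fun y => by
    ext i
    simp only [hz, map_mul, map_add, MvPolynomial.aeval_X, MvPolynomial.aeval_C, eq_ratCast]
    push_cast
    ring
  have hDsa : IsSemialgebraic ℚ {y : Fin m → ℝ | z y ∈ r.domain} := by
    have := r.isSemialgebraic_domain.preimage_aeval (fun i : Fin m =>
      ((MvPolynomial.X i + MvPolynomial.C (k i : ℚ)) * MvPolynomial.C ((1 : ℚ) / 2 ^ j) :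
        MvPolynomial (Fin m) ℚ))
    have heq : (fun (y : Fin m → ℝ) (i : Fin m) => MvPolynomial.aeval y
        ((MvPolynomial.X i + MvPolynomial.C (k i : ℚ)) * MvPolynomial.C ((1 : ℚ) / 2 ^ j) :
          MvPolynomial (Fin m) ℚ)) = z := funext hzpoly
    rwa [heq] at this
  have hD'sa : IsSemialgebraic ℚ {y : Fin m → ℝ | z y ∈ r.domain ∩ closedCube j k} := by
    have := (r.isSemialgebraic_domain.inter (isSemialgebraic_closedCube j k)).preimage_aeval
      (fun i : Fin m => ((MvPolynomial.X i + MvPolynomial.C (k i : ℚ)) *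
        MvPolynomial.C ((1 : ℚ) / 2 ^ j) : MvPolynomial (Fin m) ℚ))
    have heq : (fun (y : Fin m → ℝ) (i : Fin m) => MvPolynomial.aeval y
        ((MvPolynomial.X i + MvPolynomial.C (k i : ℚ)) * MvPolynomial.C ((1 : ℚ) / 2 ^ j) :
          MvPolynomial (Fin m) ℚ)) = z := funext hzpoly
    rwa [heq] at this
  have hD'sub : {y : Fin m → ℝ | z y ∈ r.domain ∩ closedCube j k} ⊆ KZ.cube m := fun y hy =>
    mem_cube_of_sample_mem_closedCube hy.2
  have hD'fin : volume {y : Fin m → ℝ | z y ∈ r.domain ∩ closedCube j k} ≠ ⊤ :=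
    ((KZ.isCompact_cube.isBounded).subset hD'sub).measure_lt_top.ne
  -- the blown-up piece `r' = ∫_{D'} 2^{-jm}`
  let r' : KZ.IntegralRep m :=
    ⟨{y | z y ∈ r.domain ∩ closedCube j k}, fun _ => ((1 : ℝ) / 2 ^ j) ^ m, hD'sa, hconst hD'sa,
      integrableOn_const hD'fin⟩
  -- rule (2) along `Φ x = 2ʲ x − k`
  have hΦpoly : ∀ x : Fin m → ℝ, (fun i => MvPolynomial.aeval x
      (MvPolynomial.C ((2 : ℚ) ^ j) * MvPolynomial.X i - MvPolynomial.C (k i : ℚ) :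
        MvPolynomial (Fin m) ℚ)) = (2 : ℝ) ^ j • x - fun i => (k i : ℝ) := fun x => by
    ext i
    simp only [map_sub, map_mul, MvPolynomial.aeval_X, MvPolynomial.aeval_C, eq_ratCast,
      Pi.sub_apply, Pi.smul_apply, smul_eq_mul]
    push_cast
    ring
  have ecov : KZ.of P - KZ.of r' ∈ KZ.changeOfVariablesRel := by
    refine ⟨m, P, r', fun x => (2 : ℝ) ^ j • x - fun i => (k i : ℝ),
      fun _ => (2 : ℝ) ^ j • ContinuousLinearMap.id ℝ (Fin m → ℝ), ?_, ?_, ?_, ?_, ?_, rfl⟩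
    · exact (isSemialgebraicMapOn_aeval P.isSemialgebraic_domain fun i =>
        (MvPolynomial.C ((2 : ℚ) ^ j) * MvPolynomial.X i - MvPolynomial.C (k i : ℚ) :
          MvPolynomial (Fin m) ℚ)).congr fun x _ => hΦpoly x
    · exact fun x _ => (((hasFDerivAt_id x).const_smul ((2 : ℝ) ^ j)).sub_const _).hasFDerivWithinAt
    · intro x _ y _ hxy
      have h := congr_arg (fun w => w + fun i => (k i : ℝ)) hxy
      simp only [sub_add_cancel] at h
      exact smul_right_injective (Fin m → ℝ) hpos.ne' h
    · ext y
      simp only [hP, KZ.IntegralRep.domain_restrict, mem_setOf_eq, mem_image, r']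
      constructor
      · rintro ⟨hy1, hy2⟩
        refine ⟨z y, ⟨hy1, hy2⟩, ?_⟩
        ext i
        simp only [hz, Pi.sub_apply, Pi.smul_apply, smul_eq_mul]
        field_simp
        ring
      · rintro ⟨x, hx, rfl⟩
        have hzx : z ((2 : ℝ) ^ j • x - fun i => (k i : ℝ)) = x := by
          ext i
          simp only [hz, Pi.sub_apply, Pi.smul_apply, smul_eq_mul]
          field_simp
          ring
        rw [hzx]
        exact hx
    · intro x hx
      have hx' : x ∈ r.domain := hx.1
      simp only [hP, KZ.IntegralRep.integrand_restrict, h1 x hx', r', det_smul_id_eq_pow, abs_pow,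
        abs_of_pos hpos]
      rw [div_pow, one_pow, one_div, inv_mul_cancel₀ (pow_ne_zero _ hpos.ne')]
  -- the extension by zero `E = ∫_{[0,1]^m} 2^{-jm} · 1_D`
  have hEsa : IsSemialgebraicFunOn ℚ (KZ.cube m)
      ({y : Fin m → ℝ | z y ∈ r.domain}.indicator fun _ => ((1 : ℝ) / 2 ^ j) ^ m) :=
    IsSemialgebraicFunOn.indicator KZ.isSemialgebraic_cube hDsa
      (hconst ((KZ.isSemialgebraic_cube (n := m)).inter hDsa))
  have hEint : IntegrableOn ({y : Fin m → ℝ | z y ∈ r.domain}.indicator fun _ => ((1 : ℝ) / 2 ^ j) ^ m)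
      (KZ.cube m) :=
    (integrableOn_const (by simp)).indicator hDsa.measurableSet_holds
  let E : KZ.IntegralRep m := ⟨KZ.cube m, _, KZ.isSemialgebraic_cube, hEsa, hEint⟩
  refine ⟨E, rfl, rfl, ?_⟩
  -- rule (1): `[E] ≡ [E | D'] + [E | cube ∖ D']`, the second piece has integrand `0`
  have hCDsa : IsSemialgebraic ℚ (KZ.cube m \ {y | z y ∈ r.domain ∩ closedCube j k}) :=
    KZ.isSemialgebraic_cube.diff hD'sa
  set ED := E.restrict {y | z y ∈ r.domain ∩ closedCube j k} hD'sa hD'sub with hED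
  set EC := E.restrict (KZ.cube m \ {y | z y ∈ r.domain ∩ closedCube j k}) hCDsa Set.sdiff_subset
    with hEC
  have e1 : KZ.of E - KZ.of ED - KZ.of EC ∈ KZ.relations :=
    KZ.domainAddRel_subset_relations ⟨m, E, ED, EC, by
      simp only [hED, hEC, KZ.IntegralRep.domain_restrict]
      exact (Set.union_sdiff_cancel hD'sub).symm,
      by rw [show ED.domain ∩ EC.domain = ∅ from
          eq_empty_of_forall_notMem fun x hx => hx.2.2 hx.1, measure_empty],
      fun _ _ => rfl, fun _ _ => rfl, rfl⟩
  have e2 : KZ.of EC ∈ KZ.relations := by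
    refine KZ.of_mem_relations_of_eqOn_zero EC fun y hy => ?_
    have hy' : y ∉ {y : Fin m → ℝ | z y ∈ r.domain} := fun h =>
      hy.2 ⟨h, sample_mem_closedCube hy.1⟩
    simp [hEC, E, indicator_of_notMem hy']
  have e3 : KZ.of ED - KZ.of r' ∈ KZ.relations := by
    refine KZ.of_sub_of_mem_relations_of_eqOn rfl fun y hy => ?_
    have hy' : y ∈ {y : Fin m → ℝ | z y ∈ r.domain} := hy.1
    simp [hED, E, indicator_of_mem hy', r']
  have : KZ.of P - KZ.of E = (KZ.of P - KZ.of r') - (KZ.of ED - KZ.of r') -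
      (KZ.of E - KZ.of ED - KZ.of EC) - KZ.of EC := by abel
  rw [this]
  exact KZ.relations.sub_mem (KZ.relations.sub_mem (KZ.relations.sub_mem
    (KZ.changeOfVariablesRel_subset_relations ecov) e3) e1) e2

/-! ### Cutting a bounded volume form along the closed grid cubes -/

/-- **Dissection along the grid** (iterated rule (1)): a representation with domain in the box
`[0, L/2ʲ)^m` is move-equivalent to the sum of its restrictions to the closed grid cubes of level
`j` (the cubes cover the box; distinct closed cubes overlap in null sets).
[cite: ViuSos2021, §4.2] [folklore] -/
theorem of_sub_sum_closedCubePieces_mem_relations (r : KZ.IntegralRep m) (j L : ℕ)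
    (hbox : ∀ x ∈ r.domain, ∀ i, 0 ≤ x i ∧ x i * 2 ^ j < L) :
    KZ.of r - ∑ K ∈ Finset.range (L ^ m), KZ.of (r.restrict (r.domain ∩ closedCube j (digits m L K))
      (r.isSemialgebraic_domain.inter (isSemialgebraic_closedCube j _)) inter_subset_left) ∈
      KZ.relations := by
  classical
  refine KZ.of_sub_sum_of_mem_relations (Finset.range (L ^ m)) r _ (fun K _ => ?_)
    (fun K _ _ _ => rfl) ?_ ?_
  · rw [KZ.IntegralRep.domain_restrict, Set.sdiff_eq_empty.mpr inter_subset_left, measure_empty]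
  · rw [Set.sdiff_eq_empty.mpr, measure_empty]
    intro x hx
    obtain ⟨K, hK, hxK⟩ := KZ.exists_mem_outerIdx_mem_hoCube hx (hbox x hx)
    have hK' : K ∈ Finset.range (L ^ m) := Finset.mem_range.mpr (coe_outerIdx_subset _ j L hK)
    exact mem_biUnion hK' ⟨hx, hoCube_subset_closedCube j _ hxK⟩
  · intro K hK K' hK' hne
    have hd : digits m L K ≠ digits m L K' := fun h =>
      hne (digits_injOn m L (Finset.mem_range.mp hK) (Finset.mem_range.mp hK') h)
    refine measure_mono_null (t := closedCube j (digits m L K) ∩ closedCube j (digits m L K'))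
      (fun x hx => ⟨hx.1.2, hx.2.2⟩) (volume_closedCube_inter_closedCube hd)

/-! ### The Riemann average of a bounded volume form -/

/-- **The Riemann average.** A representation `r` with integrand `1` and domain in the box
`[0, L/2ʲ)^m` is move-equivalent to ONE representation on the unit cube `[0,1]^m` whose integrand
is the Riemann sum `w_r(y) = 2^{-jm} · #{K < L^m : (y + k_K)/2ʲ ∈ r.domain}` (cut along the grid,
blow every piece up onto the unit cube, extend by zero, add the integrands).
[cite: Yoshinaga2008, §3.4] [folklore] -/
theorem exists_cubeAverage_of_mem_box (r : KZ.IntegralRep m) (h1 : ∀ x ∈ r.domain, r.integrand x = 1)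
    (j L : ℕ) (hbox : ∀ x ∈ r.domain, ∀ i, 0 ≤ x i ∧ x i * 2 ^ j < L) :
    ∃ W : KZ.IntegralRep m, W.domain = KZ.cube m ∧
      (W.integrand = fun y => ∑ K ∈ Finset.range (L ^ m),
        {y : Fin m → ℝ | (fun i => (y i + (digits m L K i : ℝ)) / 2 ^ j) ∈ r.domain}.indicator
          (fun _ => ((1 : ℝ) / 2 ^ j) ^ m) y) ∧
      KZ.of r - KZ.of W ∈ KZ.relations := by
  classical
  choose E hEd hEi hErel using fun K : ℕ => exists_cubeSample r h1 j (digits m L K)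
  set S := Finset.range (L ^ m) with hS
  have hWsa : IsSemialgebraicFunOn ℚ (KZ.cube m) (fun y => ∑ K ∈ S,
      {y : Fin m → ℝ | (fun i => (y i + (digits m L K i : ℝ)) / 2 ^ j) ∈ r.domain}.indicator
        (fun _ => ((1 : ℝ) / 2 ^ j) ^ m) y) :=
    KZ.isSemialgebraicFunOn_finset_sum S KZ.isSemialgebraic_cube fun K _ => by
      rw [← hEi K, ← hEd K]; exact (E K).isSemialgebraicFunOn_integrand
  have hWint : IntegrableOn (fun y => ∑ K ∈ S,
      {y : Fin m → ℝ | (fun i => (y i + (digits m L K i : ℝ)) / 2 ^ j) ∈ r.domain}.indicator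
        (fun _ => ((1 : ℝ) / 2 ^ j) ^ m) y) (KZ.cube m) :=
    integrable_finsetSum S fun K _ => by
      have h := (E K).integrableOn
      rw [hEd K, hEi K] at h
      exact h
  let W : KZ.IntegralRep m := ⟨KZ.cube m, _, KZ.isSemialgebraic_cube, hWsa, hWint⟩
  refine ⟨W, rfl, rfl, ?_⟩
  have e1 := of_sub_sum_closedCubePieces_mem_relations r j L hbox
  have e2 : ∑ K ∈ S, KZ.of (r.restrict (r.domain ∩ closedCube j (digits m L K))
      (r.isSemialgebraic_domain.inter (isSemialgebraic_closedCube j _)) inter_subset_left) -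
      ∑ K ∈ S, KZ.of (E K) ∈ KZ.relations :=
    KZ.sum_sub_sum_mem_relations S _ _ fun K _ => hErel K
  have e3 : KZ.of W - ∑ K ∈ S, KZ.of (E K) ∈ KZ.relations :=
    KZ.of_sub_sum_integrand_mem_relations S E W (fun K _ => hEd K) fun y _ => by
      simp only [W, hEi]
  have : KZ.of r - KZ.of W = (KZ.of r - ∑ K ∈ S, KZ.of (r.restrict (r.domain ∩ closedCube j (digits m L K))
      (r.isSemialgebraic_domain.inter (isSemialgebraic_closedCube j _)) inter_subset_left)) +
      (∑ K ∈ S, KZ.of (r.restrict (r.domain ∩ closedCube j (digits m L K))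
        (r.isSemialgebraic_domain.inter (isSemialgebraic_closedCube j _)) inter_subset_left) -
        ∑ K ∈ S, KZ.of (E K)) - (KZ.of W - ∑ K ∈ S, KZ.of (E K)) := by abel
  rw [this]
  exact KZ.relations.sub_mem (KZ.relations.add_mem e1 e2) e3

/-- **The Riemann average** (registered sub-goal `exists_cubeAverage` of crux `KernelForm`, line
`Sketch`; `∀`-form of `exists_cubeAverage_of_mem_box`): a representation with integrand `1` and
domain in the box `[0, L/2ʲ)^m` is move-equivalent to the unit-cube representation with integrand
the Riemann sum `2^{-jm} · #{K < L^m : (y + k_K)/2ʲ ∈ r.domain}`. [cite: Yoshinaga2008, §3.4]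
[folklore] -/
theorem exists_cubeAverage :
    ∀ {m : ℕ} (r : KZ.IntegralRep m), (∀ x ∈ r.domain, r.integrand x = 1) → ∀ (j L : ℕ),
      (∀ x ∈ r.domain, ∀ i, 0 ≤ x i ∧ x i * 2 ^ j < L) → ∃ W : KZ.IntegralRep m,
        W.domain = KZ.cube m ∧ (W.integrand = fun y => ∑ K ∈ Finset.range (L ^ m),
          {y : Fin m → ℝ | (fun i => (y i + (digits m L K i : ℝ)) / 2 ^ j) ∈ r.domain}.indicator
            (fun _ => ((1 : ℝ) / 2 ^ j) ^ m) y) ∧ KZ.of r - KZ.of W ∈ KZ.relations :=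
  fun r h1 j L hbox => exists_cubeAverage_of_mem_box r h1 j L hbox

/-- **The Riemann sum is squeezed between the inner and the outer cube count.** For `y ∈ [0,1]^m`
the sample point `(y + k_K)/2ʲ` lies in the closed cube `Q_K`; so every cube inside `s` contributes
to `w_s(y)`, and every contributing cube meets `s`. [cite: Yoshinaga2008, §3.4] [folklore] -/
theorem card_innerIdx_mul_le_cubeAverage (s : Set (Fin m → ℝ)) (j L : ℕ) {y : Fin m → ℝ}
    (hy : y ∈ KZ.cube m) :
    ((innerIdx s j L).card : ℝ) * ((1 : ℝ) / 2 ^ j) ^ m ≤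
      ∑ K ∈ Finset.range (L ^ m),
        {y : Fin m → ℝ | (fun i => (y i + (digits m L K i : ℝ)) / 2 ^ j) ∈ s}.indicator
          (fun _ => ((1 : ℝ) / 2 ^ j) ^ m) y ∧
    ∑ K ∈ Finset.range (L ^ m),
        {y : Fin m → ℝ | (fun i => (y i + (digits m L K i : ℝ)) / 2 ^ j) ∈ s}.indicator
          (fun _ => ((1 : ℝ) / 2 ^ j) ^ m) y ≤
      ((outerIdx s j L).card : ℝ) * ((1 : ℝ) / 2 ^ j) ^ m := by
  classical
  have hsum : ∑ K ∈ Finset.range (L ^ m),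
      {y : Fin m → ℝ | (fun i => (y i + (digits m L K i : ℝ)) / 2 ^ j) ∈ s}.indicator
        (fun _ => ((1 : ℝ) / 2 ^ j) ^ m) y =
      (((Finset.range (L ^ m)).filter fun K =>
        (fun i => (y i + (digits m L K i : ℝ)) / 2 ^ j) ∈ s).card : ℝ) * ((1 : ℝ) / 2 ^ j) ^ m := by
    simp only [Set.indicator_apply, mem_setOf_eq]
    rw [← Finset.sum_filter, Finset.sum_const, nsmul_eq_mul]
  rw [hsum]
  have hpos : (0 : ℝ) ≤ ((1 : ℝ) / 2 ^ j) ^ m := by positivity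
  constructor
  · refine mul_le_mul_of_nonneg_right (Nat.cast_le.mpr ?_) hpos
    exact Finset.card_le_card fun K hK => by
      simp only [innerIdx, Finset.mem_filter] at hK
      exact Finset.mem_filter.mpr ⟨hK.1, hK.2 (sample_mem_closedCube hy)⟩
  · refine mul_le_mul_of_nonneg_right (Nat.cast_le.mpr ?_) hpos
    exact Finset.card_le_card fun K hK => by
      rw [Finset.mem_filter] at hK
      simp only [outerIdx, Finset.mem_filter]
      exact ⟨hK.1, ⟨_, sample_mem_closedCube hy, hK.2⟩⟩

/-- **The Riemann sum is uniformly close to the volume**: if the gap between the outer and inner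
cube counts of `s` (times the cube volume) is at most `η`, then `|w_s(y) − vol s| ≤ η` on
`[0,1]^m`. [cite: Yoshinaga2008, §3.6] [folklore] -/
theorem abs_cubeAverage_sub_volume_le {s : Set (Fin m → ℝ)} (hs : Bornology.IsBounded s)
    (j L : ℕ) (hbox : ∀ x ∈ s, ∀ i, 0 ≤ x i ∧ x i * 2 ^ j < L) {η : ℝ} (hη : 0 ≤ η)
    (hgap : (((outerIdx s j L).card - (innerIdx s j L).card : ℕ) : ℝ≥0∞) *
      ENNReal.ofReal (((1 : ℝ) / 2 ^ j) ^ m) ≤ ENNReal.ofReal η)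
    {y : Fin m → ℝ} (hy : y ∈ KZ.cube m) :
    |∑ K ∈ Finset.range (L ^ m),
        {y : Fin m → ℝ | (fun i => (y i + (digits m L K i : ℝ)) / 2 ^ j) ∈ s}.indicator
          (fun _ => ((1 : ℝ) / 2 ^ j) ^ m) y - volume.real s| ≤ η := by
  obtain ⟨hlo, hhi⟩ := card_innerIdx_mul_le_cubeAverage s j L hy
  set w := ∑ K ∈ Finset.range (L ^ m),
        {y : Fin m → ℝ | (fun i => (y i + (digits m L K i : ℝ)) / 2 ^ j) ∈ s}.indicator
          (fun _ => ((1 : ℝ) / 2 ^ j) ^ m) y with hw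
  set h : ℝ := ((1 : ℝ) / 2 ^ j) ^ m with hh
  have h0 : 0 ≤ h := by positivity
  have hfin : volume s ≠ ⊤ := hs.measure_lt_top.ne
  have hio : (innerIdx s j L).card ≤ (outerIdx s j L).card :=
    Finset.card_le_card (innerIdx_subset_outerIdx s j L)
  -- inner count ≤ volume
  have h1 : ((innerIdx s j L).card : ℝ) * h ≤ volume.real s := by
    have h' := card_innerIdx_mul_le s j L
    rw [measureReal_def, ← ENNReal.ofReal_le_iff_le_toReal hfin,
      ENNReal.ofReal_mul (by positivity), ENNReal.ofReal_natCast]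
    exact h'
  -- volume ≤ outer count
  have h2 : volume.real s ≤ ((outerIdx s j L).card : ℝ) * h := by
    have h' := le_card_outerIdx_mul s j L hbox
    rw [measureReal_def, ← ENNReal.ofReal_natCast, ← ENNReal.ofReal_mul (by positivity)] at *
    exact ENNReal.toReal_le_of_le_ofReal (by positivity) h'
  -- the gap
  have h3 : (((outerIdx s j L).card : ℝ) - (innerIdx s j L).card) * h ≤ η := by
    have h' := hgap
    rw [← ENNReal.ofReal_natCast, ← ENNReal.ofReal_mul (by positivity),
      ENNReal.ofReal_le_ofReal_iff hη, Nat.cast_sub hio] at h'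
    exact h'
  rw [abs_le]
  constructor <;> nlinarith

end Summit.KontsevichZagierPeriods.KernelForm.LocaliseAtValuePrime
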